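import Mathlib.Combinatorics.SimpleGraph.Maps
import Mathlib.Data.List.Lex
import Mathlib.Data.Finset.Max
import Literature.Computability.Complexity.GraphCanonization
import HarnessLib

/-!
# Lexicographic leaders over invariant labeling sets are canonical forms (Babai–Luks 1983, §1, §3)

The common correctness skeleton of canonical LABELING algorithms (Babai–Luks 1983; Corneil–Goldberg
1984; individualisation–refinement): to every vertex-coloured graph `X = (G, col)` on `Fin k` the
algorithm attaches, in an isomorphism-EQUIVARIANT way, a nonempty finite set `L(X)` of labelings
`e : Fin k ≃ Fin k` (new vertex `i` ↦ old vertex `e i`; e.g. the leaves of a canonically built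
search tree, or a canonical labeling coset `Aut(X) π`), and outputs the lexicographically least
("lexicographic leader", Babai–Luks §1) of the codes of the relabelled graphs `X^e`. This file
proves, once and for all and free of any machine model, that such an output IS a canonical form in
the sense of `babaiLuks1983_canonicalForm` (`GraphCanonization.lean`):

* `relabelCode k G col e = colGraphCode k (G.comap e) (col ∘ e)` — the code of the relabelled
  coloured graph; it is colour-isomorphic to the original (`ColIso.comap_equiv`), and EQUIVARIANT:
  `relabelCode G₂ c₂ (e.trans σ) = relabelCode G₁ c₁ e` for a colour-preserving isomorphism
  `σ : G₁ ≃g G₂` (`relabelCode_trans`);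
* `leaderCode S hS G col` — the least code over a nonempty finite set `S` of labelings (Mathlib's
  lexicographic `LinearOrder (List Bool)`; all candidate codes have the same length);
* **`leader_isCanonicalForm`**: for a labeling-set function `L` that is nonempty-valued and
  equivariant (`L(X^σ) = L(X)·σ`, stated as `L k G₂ c₂ = (L k G₁ c₁).image (·.trans σ)`), the map
  `X ↦ leaderCode (L X) X` satisfies both clauses of `babaiLuks1983_canonicalForm`: its value is the
  code of a coloured graph colour-isomorphic to `X`, and colour-isomorphic inputs give equal values.

The machine side (computing the leader within the time bound) is `GraphCanonizationProofs.lean`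
(`babaiLuks1983_canonicalForm_of_leader`). Not here: any particular labeling-set function `L` (the
search tree of a concrete algorithm and the bound on its size).

## References

* L. Babai, E. M. Luks, *Canonical labeling of graphs*, STOC 1983, 171–183,
  doi:10.1145/800061.808746, §1 (canonical forms, "lexicographic leader"), §3 (canonical labeling
  cosets `CL(X) = Aut(X) π`, `CF(X) = X^{CL(X)}`). [BabaiLuks1983]
-/

namespace Literature.Computability.Complexity

open _root_.Computability

variable {k : ℕ}

/-! ### Relabelling along a permutation -/

/-- Relabelling a coloured graph along `e : Fin k ≃ Fin k` (new vertex `i` is old vertex `e i`: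
graph `G.comap e`, colours `col ∘ e`) gives a colour-isomorphic coloured graph (the isomorphism is
`e.symm`). [cite: BabaiLuks1983, §1 (X^σ ≅ X)] -/
theorem ColIso.comap_equiv (G : SimpleGraph (Fin k)) (col : Fin k → ℕ) (e : Fin k ≃ Fin k) :
    ColIso k G col (G.comap e) (col ∘ e) :=
  ⟨(SimpleGraph.Iso.comap e G).symm, fun v => by simp⟩

/-- The code of the coloured graph relabelled along `e`: `colGraphCode k (G.comap e) (col ∘ e)`.
[cite: BabaiLuks1983, §1 (the string X^σ)] -/
noncomputable def relabelCode (k : ℕ) (G : SimpleGraph (Fin k)) (col : Fin k → ℕ)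
    (e : Equiv.Perm (Fin k)) : List Bool :=
  colGraphCode k (G.comap e) (col ∘ e)

/-- The relabelled code is the code of a colour-isomorphic coloured graph. [cite: BabaiLuks1983, §1] -/
theorem relabelCode_colIso (G : SimpleGraph (Fin k)) (col : Fin k → ℕ) (e : Equiv.Perm (Fin k)) :
    ∃ (G' : SimpleGraph (Fin k)) (col' : Fin k → ℕ),
      relabelCode k G col e = colGraphCode k G' col' ∧ ColIso k G col G' col' :=
  ⟨_, _, rfl, ColIso.comap_equiv G col e⟩

/-- **Equivariance of relabelled codes**: for a colour-preserving isomorphism `σ : G₁ ≃g G₂`, the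
labeling `e.trans σ` of `(G₂, c₂)` (new vertex `i` ↦ `σ (e i)`) yields the same code as the labeling
`e` of `(G₁, c₁)`: `(X^σ)^{(σ⁻¹ ·) ∘ …}`-bookkeeping, `X₂.comap (σ ∘ e) = X₁.comap e`.
[cite: BabaiLuks1983, §3 (CF(X^σ, σ⁻¹Gσ) bookkeeping)] -/
theorem relabelCode_trans {G₁ G₂ : SimpleGraph (Fin k)} {c₁ c₂ : Fin k → ℕ} (σ : G₁ ≃g G₂)
    (hσ : ∀ v, c₂ (σ v) = c₁ v) (e : Equiv.Perm (Fin k)) :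
    relabelCode k G₂ c₂ (e.trans σ.toEquiv) = relabelCode k G₁ c₁ e := by
  unfold relabelCode
  congr 1
  · ext i j
    simp only [SimpleGraph.comap_adj, Equiv.trans_apply, RelIso.coe_fn_toEquiv]
    exact σ.map_rel_iff
  · funext i
    simp [hσ]

/-! ### The lexicographic leader -/

/-- The **lexicographic leader** of a coloured graph over a nonempty finite set `S` of labelings:
the least of the codes `relabelCode k G col e`, `e ∈ S`, in the lexicographic order of bit strings
(Mathlib's `LinearOrder (List Bool)`, `false < true`). [cite: BabaiLuks1983, §1 ("lexicographic leader")] -/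
noncomputable def leaderCode (S : Finset (Equiv.Perm (Fin k))) (hS : S.Nonempty)
    (G : SimpleGraph (Fin k)) (col : Fin k → ℕ) : List Bool :=
  (S.image (relabelCode k G col)).min' (hS.image _)

/-- The leader is attained: it is the code of the relabelling along some `e ∈ S`. [folklore] -/
theorem exists_leaderCode_eq (S : Finset (Equiv.Perm (Fin k))) (hS : S.Nonempty)
    (G : SimpleGraph (Fin k)) (col : Fin k → ℕ) :
    ∃ e ∈ S, leaderCode S hS G col = relabelCode k G col e := by
  obtain ⟨e, he, heq⟩ := Finset.mem_image.1 (Finset.min'_mem (S.image (relabelCode k G col)) (hS.image _))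
  exact ⟨e, he, heq.symm⟩

/-- The leader is a lower bound of the candidate codes. [folklore] -/
theorem leaderCode_le (S : Finset (Equiv.Perm (Fin k))) (hS : S.Nonempty) (G : SimpleGraph (Fin k))
    (col : Fin k → ℕ) {e : Equiv.Perm (Fin k)} (he : e ∈ S) :
    leaderCode S hS G col ≤ relabelCode k G col e :=
  Finset.min'_le _ _ (Finset.mem_image_of_mem _ he)

/-- **First clause**: the leader is the code of a coloured graph colour-isomorphic to the input.
[cite: BabaiLuks1983, §1 (CF(X) ≅ X)] -/
theorem leaderCode_colIso (S : Finset (Equiv.Perm (Fin k))) (hS : S.Nonempty) (G : SimpleGraph (Fin k))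
    (col : Fin k → ℕ) :
    ∃ (G' : SimpleGraph (Fin k)) (col' : Fin k → ℕ),
      leaderCode S hS G col = colGraphCode k G' col' ∧ ColIso k G col G' col' := by
  obtain ⟨e, -, he⟩ := exists_leaderCode_eq S hS G col
  exact ⟨_, _, he, ColIso.comap_equiv G col e⟩

/-- **Second clause**: if the labeling set of `(G₂, c₂)` is the translate `S₁ · σ` of that of
`(G₁, c₁)` along a colour-preserving isomorphism `σ : G₁ ≃g G₂`, the two leaders coincide (the two
candidate code sets are equal by `relabelCode_trans`). [cite: BabaiLuks1983, §1 (X ≅ Y → CF(X) = CF(Y))] -/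
theorem leaderCode_eq_of_image {G₁ G₂ : SimpleGraph (Fin k)} {c₁ c₂ : Fin k → ℕ}
    {S₁ S₂ : Finset (Equiv.Perm (Fin k))} (h₁ : S₁.Nonempty) (h₂ : S₂.Nonempty) (σ : G₁ ≃g G₂)
    (hσ : ∀ v, c₂ (σ v) = c₁ v) (hS : S₂ = S₁.image fun e => e.trans σ.toEquiv) :
    leaderCode S₁ h₁ G₁ c₁ = leaderCode S₂ h₂ G₂ c₂ := by
  have himg : S₂.image (relabelCode k G₂ c₂) = S₁.image (relabelCode k G₁ c₁) := by
    subst hS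
    rw [Finset.image_image]
    exact Finset.image_congr fun e _ => relabelCode_trans σ hσ e
  apply le_antisymm
  · exact Finset.min'_le _ _ (himg ▸ Finset.min'_mem _ _)
  · exact Finset.min'_le _ _ (himg.symm ▸ Finset.min'_mem _ _)

/-- **Lexicographic leaders over equivariant nonempty labeling sets are canonical forms.** For a
labeling-set function `L` (to each coloured graph on `Fin k` a finite set of labelings) that is
nonempty-valued and equivariant under colour-preserving isomorphisms — `L k G₂ c₂` is the image of
`L k G₁ c₁` under `e ↦ e.trans σ` for every colour-preserving `σ : G₁ ≃g G₂` — the map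
`(G, col) ↦ leaderCode (L k G col) _ G col` satisfies both clauses of `babaiLuks1983_canonicalForm`:
its value is the code of a colour-isomorphic coloured graph, and colour-isomorphic inputs have equal
values. (Instances: `L(X)` = a canonical labeling coset `Aut(X) π` of Babai–Luks §3, or the leaf set
of an isomorphism-invariantly constructed search tree.) [cite: BabaiLuks1983, §1 and §3 (CF(X) = X^{CL(X)})] -/
theorem leader_isCanonicalForm
    (L : ∀ k : ℕ, SimpleGraph (Fin k) → (Fin k → ℕ) → Finset (Equiv.Perm (Fin k)))
    (hne : ∀ (k : ℕ) (G : SimpleGraph (Fin k)) (col : Fin k → ℕ), (L k G col).Nonempty)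
    (heqv : ∀ (k : ℕ) (G₁ : SimpleGraph (Fin k)) (c₁ : Fin k → ℕ) (G₂ : SimpleGraph (Fin k))
      (c₂ : Fin k → ℕ) (σ : G₁ ≃g G₂), (∀ v, c₂ (σ v) = c₁ v) →
        L k G₂ c₂ = (L k G₁ c₁).image fun e => e.trans σ.toEquiv) :
    (∀ (k : ℕ) (G : SimpleGraph (Fin k)) (col : Fin k → ℕ),
        ∃ (G' : SimpleGraph (Fin k)) (col' : Fin k → ℕ),
          leaderCode (L k G col) (hne k G col) G col = colGraphCode k G' col' ∧ ColIso k G col G' col') ∧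
    ∀ (k : ℕ) (G₁ : SimpleGraph (Fin k)) (c₁ : Fin k → ℕ) (G₂ : SimpleGraph (Fin k)) (c₂ : Fin k → ℕ),
      ColIso k G₁ c₁ G₂ c₂ →
        leaderCode (L k G₁ c₁) (hne k G₁ c₁) G₁ c₁ = leaderCode (L k G₂ c₂) (hne k G₂ c₂) G₂ c₂ :=
  ⟨fun _ G col => leaderCode_colIso _ _ G col,
    fun k G₁ c₁ G₂ c₂ ⟨σ, hσ⟩ => leaderCode_eq_of_image _ _ σ hσ (heqv k G₁ c₁ G₂ c₂ σ hσ)⟩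

end Literature.Computability.Complexity
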